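import Mathlib.Analysis.Convolution
import Mathlib.MeasureTheory.Group.LIntegral
import Literature.Analysis.FunctionSpaces.SobolevDomainProofs
import Literature.Analysis.FluidPDE.ForwardDSSLocalEnergyScaling
import HarnessLib

/-!
# Forward DSS solutions: the mollified drift `η_{ε√t} * v` of Bradshaw–Tsai 2019, (3.5) and (3.10)

Analysis/FluidPDE definition file in the decomposition of
`Literature.Analysis.FluidPDE.bradshawTsai2019_prop_3_1` (Bradshaw–Tsai, Analysis & PDE 12 (2019)
= arXiv:1801.08060, Prop. 3.1; the remaining analytic input is the a priori estimate (3.12) for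
the mollified approximants, cf. `bradshawTsai2019_prop_3_1_approximation` in
`ForwardDSSLocalEnergyLimit`). The approximants solve the mollified Navier–Stokes equations

> (3.5) `∂ₜv_ε − Δv_ε + (η_{ε√t} * v_ε)·∇v_ε + ∇π_ε = 0`, "where `η_ε(y) = ε⁻³η(y/ε)` and
> `η ∈ C₀^∞(ℝ³)`, is non-negative, and satisfies `∫η(y) dy = 1`" (3.4); "Note the time dependence
> of the convolution kernel `η_{ε√t}` in (3.5)."

and the proof of (3.12) uses two properties of the drift `b_ε = η_{ε√t} * v_ε`: it is `λ`-DSS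
together with `v_ε` (this is why the mollification scale is `ε√t`; used in the far-field
pressure estimate, p. 10: "`∫_{A_k} … = λ^{-2k}∫_{A₀} |(η_{ε√(tλ^{-2k})} * v_ε)(z, tλ^{-2k})| …`"),
and the local `L^q` bound

> (3.10) "By taking `ε` sufficiently small we can ensure that, whenever `s < 1`,
> `supp η_{ε√s} ⊂ B_{λ−1}`. Note `λᵏ + (λ−1) ≤ λ^{k+1}` for all `k ≥ 0`. Thus, for `x ∈ B_λ`,
> `|(η_{ε√s} * v_ε)(x,s)| ≤ ∫ η_{ε√s}(y)|v_ε(x−y,s)| dy = (η_{ε√s} * (χ_{B_{λ²}}|v_ε|))(x,s)` …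
> `‖(η_{ε√s} * v_ε)(s)‖_{L^q(B_λ)} ≤ C(q,η)‖v_ε(s)‖_{L^q(B_{λ²})}` … where `C` is independent of
> `s` and `ε`. Note that this estimate is also valid if `B_λ` is replaced by `B_{λ²}`."

This file defines the objects and **proves** both properties:

* `BradshawTsai2019.scaledMollifier η δ` — `η_δ(y) = δ⁻ⁿ η(y/δ)` on an `n`-dimensional real
  inner product space `E` (mass `∫η_δ = ∫η`, `integral_scaledMollifier`; support in `B_{δρ}`
  when `supp η ⊆ B_ρ`, `scaledMollifier_eq_zero`; the scaling identity `η_{cδ}(cz) = c⁻ⁿ η_δ(z)`,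
  `scaledMollifier_mul_smul`). This is the general-`E` form of the tree's
  `FluidPDE.mollifierScale ε φ ξ = (ε ^ card d)⁻¹ φ(ε⁻¹ξ)` on `EuclideanSpace ℝ d`
  (`DissipationAnomaly`, with `IsMollifier`, `integral_mollifierScale`): the same formula with
  `card d = finrank ℝ (EuclideanSpace ℝ d)`, so that `scaledMollifier η δ = mollifierScale δ η`
  there (bridge `scaledMollifier_eq_mollifierScale`, filed separately in
  `ForwardDSSMollifiedDriftBridge` so as not to import the torus files of the Duchon–Robert chain
  into the DSS chain; refactor note: one of the two should eventually be retired in favour of the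
  general-`E` version, over which the DSS files are stated).
* `BradshawTsai2019.mollifiedDrift η ε w t x = (η_{ε√t} * w(t))(x) = ∫ η_{ε√t}(y) w(t, x−y) dy`
  (Mathlib's convolution with `lsmul`; for `t ≤ 0` the scale is `ε√t = 0` and the value is junk).
* `BradshawTsai2019.isDiscretelySelfSimilar_mollifiedDrift` (**proved**): if `w` is `λ`-DSS then
  so is its drift, `λ b(λ²t, λx) = b(t, x)` (substitution `y = λz`, `η_{λδ}(λz) = λ⁻ⁿη_δ(z)`).
* `BradshawTsai2019.setLIntegral_ball_enorm_mollifiedDrift_rpow_le` (**proved**, (3.10) with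
  `C(q, η) = 1` for a non-negative unit-mass `η`): if `supp η ⊆ B_ρ`, `δ = ε√t > 0` and
  `R + δρ ≤ R'`, then `∫_{B_R} |b(t)|^q ≤ ∫_{B_{R'}} |w(t)|^q` for every `q ≥ 1` (localisation
  `η_δ(x−y) w(y) = η_δ(x−y) (χ_{B_{R'}}w)(y)` for `x ∈ B_R`; Jensen for the probability density
  `η_δ(x−·)`; Tonelli and translation invariance), and its form on the scaling orbit
  `setLIntegral_ball_pow_enorm_mollifiedDrift_rpow_le`: for `0 < t ≤ 1`, `ερ ≤ λ − 1`, `k ∈ ℕ`,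
  `∫_{B_{λᵏ}} |b(t)|^q ≤ ∫_{B_{λ^{k+1}}} |w(t)|^q`.

## Mathlib / tree search

Mathlib: `MeasureTheory.convolution` (`convolution_lsmul`, `convolution_lsmul_swap`),
`Measure.integral_comp_smul` (substitution `y = λz`), `Measure.withDensity`
(`lintegral_withDensity_eq_lintegral_mul₀`), Tonelli `lintegral_lintegral_swap`,
`lintegral_sub_right_eq_self`; Mathlib's own scaled family is `ContDiffBump.normed` (radial
bumps; the source fixes an arbitrary `η ∈ C₀^∞`, `η ≥ 0`, `∫η = 1`). Tree: the scaled mollifier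
exists as `FluidPDE.mollifierScale` on `EuclideanSpace ℝ d` (`DissipationAnomaly`; see above for
the relation and the bridge); Jensen's inequality for `lintegral` is the tree's
`FunctionSpaces.rpow_lintegral_le_lintegral_rpow` (`SobolevDomainProofs`, probability-measure
form; used here through `volume.withDensity (η_δ(x − ·))` — the density form
`FluidPDE.Torus.lintegral_mul_rpow_le_lintegral_mul_rpow` of `DuchonRobertUniformDefectOfEuler`
is the same statement and is not restated); `FluidPDE/MollifiedField` has the whole-space Jensen
bounds in `L²`, `L⁴` for a fixed kernel (`Fluid.sq_norm_convolution_le`). DSS algebra from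
`SelfSimilar`/`ForwardDSSExtension` (`nsRescale_apply`, `apply_smul_of_isDiscretelySelfSimilar`).

## References

* Z. Bradshaw, T.-P. Tsai, Analysis & PDE 12 (2019) 1943–1962 = arXiv:1801.08060, §3: (3.4),
  (3.5), (3.10) and the surrounding text (pp. 8–9), the far-field estimate p. 10
  [BradshawTsai2019].
-/

noncomputable section

open MeasureTheory Set Function Filter Topology TopologicalSpace Metric Module
open scoped NNReal ENNReal Convolution

namespace Literature.Analysis.FluidPDE

namespace BradshawTsai2019

section General

variable {E : Type*} [NormedAddCommGroup E] [InnerProductSpace ℝ E]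
variable {F : Type*} [NormedAddCommGroup F] [NormedSpace ℝ F]

/-! ## The scaled mollifiers `η_δ` -/

/-- **The scaled mollifier** `η_δ(y) = δ⁻ⁿ η(y/δ)` (`n = dim E`; Bradshaw–Tsai 2019, (3.4):
"`η_ε(y) = ε⁻³η(y/ε)`"). For `δ = 0` the value is the junk constant `0⁻ⁿη(0)`. General-`E` form
of the tree's `FluidPDE.mollifierScale δ η` (`DissipationAnomaly`, on `EuclideanSpace ℝ d` with
`card d` for `n`): on `EuclideanSpace ℝ d` the two agree (`finrank_euclideanSpace`; bridge
`scaledMollifier_eq_mollifierScale` in `ForwardDSSMollifiedDriftBridge`). [cite: BradshawTsai2019, §3 (3.4)] -/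
def scaledMollifier (η : E → ℝ) (δ : ℝ) (y : E) : ℝ :=
  (δ ^ finrank ℝ E)⁻¹ * η (δ⁻¹ • y)

/-- Unfolding `scaledMollifier`. [folklore] -/
theorem scaledMollifier_apply (η : E → ℝ) (δ : ℝ) (y : E) :
    scaledMollifier η δ y = (δ ^ finrank ℝ E)⁻¹ * η (δ⁻¹ • y) := rfl

/-- `η₁ = η`. [folklore] -/
@[simp] theorem scaledMollifier_one (η : E → ℝ) : scaledMollifier η 1 = η := by
  funext y; simp [scaledMollifier]

/-- `η_δ ≥ 0` when `η ≥ 0` and `δ ≥ 0`. [folklore] -/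
theorem scaledMollifier_nonneg {η : E → ℝ} (hη : ∀ y, 0 ≤ η y) {δ : ℝ} (hδ : 0 ≤ δ) (y : E) :
    0 ≤ scaledMollifier η δ y :=
  mul_nonneg (inv_nonneg.2 (pow_nonneg hδ _)) (hη _)

/-- **Support**: if `η` vanishes outside `B_ρ` then `η_δ` vanishes outside `B_{δρ}` (`δ > 0`).
[folklore] -/
theorem scaledMollifier_eq_zero {η : E → ℝ} {ρ : ℝ} (hη : ∀ y, ρ ≤ ‖y‖ → η y = 0) {δ : ℝ}
    (hδ : 0 < δ) {y : E} (hy : δ * ρ ≤ ‖y‖) : scaledMollifier η δ y = 0 := by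
  rw [scaledMollifier, hη _ ?_, mul_zero]
  rw [norm_smul, Real.norm_eq_abs, abs_of_pos (inv_pos.2 hδ), le_inv_mul_iff₀ hδ]
  exact hy

/-- Continuity of `η_δ`. [folklore] -/
theorem continuous_scaledMollifier {η : E → ℝ} (hη : Continuous η) (δ : ℝ) :
    Continuous (scaledMollifier η δ) :=
  continuous_const.mul (hη.comp (continuous_const_smul _))

/-- **The scaling identity** `η_{cδ}(c z) = c⁻ⁿ η_δ(z)` (`c ≠ 0`): the mechanism behind the
`λ`-DSS covariance of the drift. [folklore] -/
theorem scaledMollifier_mul_smul (η : E → ℝ) {c : ℝ} (hc : c ≠ 0) (δ : ℝ) (z : E) :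
    scaledMollifier η (c * δ) (c • z) = (c ^ finrank ℝ E)⁻¹ * scaledMollifier η δ z := by
  simp only [scaledMollifier, mul_pow, mul_inv, smul_smul]
  rw [show c⁻¹ * δ⁻¹ * c = δ⁻¹ by rw [mul_comm c⁻¹, mul_assoc, inv_mul_cancel₀ hc, mul_one]]
  ring

variable [FiniteDimensional ℝ E] [MeasurableSpace E] [BorelSpace E]

/-- **Mass**: `∫ η_δ = ∫ η` for `δ > 0` (substitution `y = δz`). [folklore] -/
theorem integral_scaledMollifier (η : E → ℝ) {δ : ℝ} (hδ : 0 < δ) :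
    ∫ y, scaledMollifier η δ y = ∫ y, η y := by
  simp only [scaledMollifier]
  rw [integral_const_mul, Measure.integral_comp_inv_smul_of_nonneg volume η hδ.le, smul_eq_mul,
    ← mul_assoc, inv_mul_cancel₀ (pow_ne_zero _ hδ.ne'), one_mul]

omit [MeasurableSpace E] [BorelSpace E] in
/-- **Compact support** of `η_δ` from `η = 0` outside `B_ρ` (`δ > 0`). [folklore] -/
theorem hasCompactSupport_scaledMollifier {η : E → ℝ} {ρ : ℝ} (hη : ∀ y, ρ ≤ ‖y‖ → η y = 0)
    {δ : ℝ} (hδ : 0 < δ) : HasCompactSupport (scaledMollifier η δ) := by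
  refine HasCompactSupport.intro (isCompact_closedBall (0 : E) (δ * ρ)) fun y hy => ?_
  rw [mem_closedBall_zero_iff, not_le] at hy
  exact scaledMollifier_eq_zero hη hδ hy.le

/-- **Unit mass in `ℝ≥0∞`**: `∫⁻ ofReal η_δ = 1` for a continuous non-negative unit-mass `η`
vanishing outside a ball (`δ > 0`). [folklore] -/
theorem lintegral_ofReal_scaledMollifier {η : E → ℝ} (hηc : Continuous η) (hη0 : ∀ y, 0 ≤ η y)
    (hη1 : ∫ y, η y = 1) {ρ : ℝ} (hηρ : ∀ y, ρ ≤ ‖y‖ → η y = 0) {δ : ℝ} (hδ : 0 < δ) :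
    ∫⁻ y, ENNReal.ofReal (scaledMollifier η δ y) = 1 := by
  have hint : Integrable (scaledMollifier η δ) volume :=
    (continuous_scaledMollifier hηc δ).integrable_of_hasCompactSupport
      (hasCompactSupport_scaledMollifier hηρ hδ)
  rw [← ofReal_integral_eq_lintegral_ofReal hint
    (Eventually.of_forall fun y => scaledMollifier_nonneg hη0 hδ.le y),
    integral_scaledMollifier η hδ, hη1, ENNReal.ofReal_one]

/-! ## The mollified drift `b_ε = η_{ε√t} * v` -/

/-- **The mollified drift** of Bradshaw–Tsai 2019, (3.5): for a field `w(t, x)`,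
`b_ε(t, x) = (η_{ε√t} * w(·,t))(x) = ∫ η_{ε√t}(y) w(t, x − y) dy`, the space convolution at time
`t` with the mollifier at the time-dependent scale `ε√t` ("Note the time dependence of the
convolution kernel `η_{ε√t}`"). Mathlib's convolution with `lsmul`; junk for `t ≤ 0`. [cite: BradshawTsai2019, §3 (3.5)] -/
def mollifiedDrift (η : E → ℝ) (ε : ℝ) (w : ℝ → E → F) (t : ℝ) (x : E) : F :=
  (scaledMollifier η (ε * Real.sqrt t) ⋆[ContinuousLinearMap.lsmul ℝ ℝ, volume] w t) x

/-- `b_ε(t, x) = ∫ η_{ε√t}(y) w(t, x − y) dy`. [cite: BradshawTsai2019, §3 (3.5)] -/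
theorem mollifiedDrift_apply (η : E → ℝ) (ε : ℝ) (w : ℝ → E → F) (t : ℝ) (x : E) :
    mollifiedDrift η ε w t x = ∫ y, scaledMollifier η (ε * Real.sqrt t) y • w t (x - y) := by
  rw [mollifiedDrift, convolution_lsmul]

/-- The symmetric form `b_ε(t, x) = ∫ η_{ε√t}(x − y) w(t, y) dy`. [folklore] -/
theorem mollifiedDrift_eq_swap (η : E → ℝ) (ε : ℝ) (w : ℝ → E → F) (t : ℝ) (x : E) :
    mollifiedDrift η ε w t x = ∫ y, scaledMollifier η (ε * Real.sqrt t) (x - y) • w t y := by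
  rw [mollifiedDrift, convolution_lsmul_swap]

/-- **The drift of a `λ`-DSS field is `λ`-DSS**: `λ b_ε(λ²t, λx) = b_ε(t, x)` (`λ > 0`), because
the scale `ε√t` is parabolic: `η_{ε√(λ²t)}(λz) = λ⁻ⁿ η_{ε√t}(z)` and `w(λ²t, λ(x−z)) = λ⁻¹w(t, x−z)`
(implicit in Bradshaw–Tsai 2019, p. 10, where the far-field integrals of `(η_{ε√t} * v_ε) v_ε`
over `A_k` are re-scaled to `A₀` at time `tλ^{-2k}`). [cite: BradshawTsai2019, §3 (3.5) and p. 10] -/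
theorem isDiscretelySelfSimilar_mollifiedDrift {c : ℝ} (hc : 0 < c) {w : ℝ → E → F}
    (hw : IsDiscretelySelfSimilar c w) (η : E → ℝ) (ε : ℝ) :
    IsDiscretelySelfSimilar c (mollifiedDrift η ε w) := by
  funext t x
  rw [nsRescale_apply, mollifiedDrift_apply, mollifiedDrift_apply]
  -- the scale at time `λ²t` is `λ` times the scale at time `t`
  have hsqrt : ε * Real.sqrt (c ^ 2 * t) = c * (ε * Real.sqrt t) := by
    rw [Real.sqrt_mul (sq_nonneg c), Real.sqrt_sq hc.le]; ring
  rw [hsqrt]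
  -- substitute `y = λ z`
  have hsub := Measure.integral_comp_smul_of_nonneg volume
    (fun y : E => scaledMollifier η (c * (ε * Real.sqrt t)) y • w (c ^ 2 * t) (c • x - y)) c
    (hR := hc.le)
  have hcn : (c ^ finrank ℝ E) ≠ 0 := pow_ne_zero _ hc.ne'
  rw [← inv_smul_eq_iff₀ (inv_ne_zero hcn), inv_inv] at hsub
  rw [← hsub, smul_comm, ← integral_smul, ← integral_smul]
  refine integral_congr_ae (Eventually.of_forall fun z => ?_)
  simp only
  rw [scaledMollifier_mul_smul η hc.ne', ← smul_sub, apply_smul_of_isDiscretelySelfSimilar hc.ne' hw,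
    inv_mul_cancel_left₀ (pow_ne_zero 2 hc.ne')]
  simp only [smul_smul]
  congr 1
  field_simp

/-! ## (3.10): local `L^q` bounds for the drift -/

/-- **Bradshaw–Tsai 2019, (3.10): the local `L^q` bound for the mollified drift**, with constant
`1` for a non-negative unit-mass mollifier. Let `η ≥ 0` be continuous with `∫η = 1` and
`η = 0` outside `B_ρ`; let `δ = ε√t > 0` and `R + δρ ≤ R'`. Then for every `q ≥ 1` and every
a.e.-strongly measurable slice `w(t)`,
`∫_{B_R} |(η_{ε√t} * w(t))(x)|^q dx ≤ ∫_{B_{R'}} |w(t, x)|^q dx`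
("for `x ∈ B_λ`, `|(η_{ε√s} * v_ε)(x,s)| ≤ … = (η_{ε√s} * (χ_{B_{λ²}}|v_ε|))(x,s)` …
`‖(η_{ε√s} * v_ε)(s)‖_{L^q(B_λ)} ≤ C(q,η)‖v_ε(s)‖_{L^q(B_{λ²})}`", proof: Jensen for the probability
density `η_δ(x − ·)`, Tonelli, translation invariance). [cite: BradshawTsai2019, §3 (3.10)] -/
theorem setLIntegral_ball_enorm_mollifiedDrift_rpow_le {η : E → ℝ} (hηc : Continuous η)
    (hη0 : ∀ y, 0 ≤ η y) (hη1 : ∫ y, η y = 1) {ρ : ℝ} (hηρ : ∀ y, ρ ≤ ‖y‖ → η y = 0)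
    {w : ℝ → E → F} {t : ℝ} (hwt : AEStronglyMeasurable (w t) volume) {ε : ℝ}
    (hδ : 0 < ε * Real.sqrt t) {R R' : ℝ} (hRR' : R + ε * Real.sqrt t * ρ ≤ R') {q : ℝ}
    (hq : 1 ≤ q) :
    ∫⁻ x in ball (0 : E) R, ‖mollifiedDrift η ε w t x‖ₑ ^ q ≤
      ∫⁻ x in ball (0 : E) R', ‖w t x‖ₑ ^ q := by
  have hq0 : 0 < q := one_pos.trans_le hq
  set δ : ℝ := ε * Real.sqrt t with hδdef
  have hηδc : Continuous (scaledMollifier η δ) := continuous_scaledMollifier hηc δ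
  set ρf : E → ℝ≥0∞ := fun y => ENNReal.ofReal (scaledMollifier η δ y) with hρf
  have hρm : Measurable ρf := ENNReal.measurable_ofReal.comp hηδc.measurable
  have hmass : ∫⁻ y, ρf y = 1 := lintegral_ofReal_scaledMollifier hηc hη0 hη1 hηρ hδ
  -- the localised slice `g = χ_{B_{R'}} w(t)`
  set g : E → F := (ball (0 : E) R').indicator (w t) with hg
  have hgm : AEStronglyMeasurable g volume := hwt.indicator measurableSet_ball
  -- pointwise: `‖b(x)‖ₑ^q ≤ ∫⁻ η_δ(x − y) ‖g(y)‖ₑ^q dy` for `x ∈ B_R` (localisation and Jensen)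
  have hpt : ∀ x ∈ ball (0 : E) R,
      ‖mollifiedDrift η ε w t x‖ₑ ^ q ≤ ∫⁻ y, ρf (x - y) * ‖g y‖ₑ ^ q := by
    intro x hx
    have hloc : ∀ y, scaledMollifier η δ (x - y) • w t y = scaledMollifier η δ (x - y) • g y := by
      intro y
      by_cases hy : y ∈ ball (0 : E) R'
      · rw [hg, indicator_of_mem hy]
      · have hxy : δ * ρ ≤ ‖x - y‖ := by
          rw [mem_ball_zero_iff, not_lt] at hy
          rw [mem_ball_zero_iff] at hx
          have h1 := norm_sub_norm_le y x
          rw [norm_sub_rev] at h1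
          linarith
        rw [scaledMollifier_eq_zero hηρ hδ hxy, zero_smul, zero_smul]
    rw [mollifiedDrift_eq_swap]
    simp_rw [← hδdef, hloc]
    have h1 : ‖∫ y, scaledMollifier η δ (x - y) • g y‖ₑ ≤ ∫⁻ y, ρf (x - y) * ‖g y‖ₑ := by
      refine (enorm_integral_le_lintegral_enorm _).trans (le_of_eq (lintegral_congr fun y => ?_))
      rw [enorm_smul, Real.enorm_eq_ofReal (scaledMollifier_nonneg hη0 hδ.le _)]
    have hρxm : AEMeasurable (fun y => ρf (x - y)) volume :=
      (hρm.comp (measurable_const.sub measurable_id)).aemeasurable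
    have hmassx : ∫⁻ y, ρf (x - y) = 1 := by rw [lintegral_sub_left_eq_self ρf x]; exact hmass
    -- Jensen for the probability measure `η_δ(x − y) dy` (the tree's probability-measure form,
    -- transported through `withDensity`)
    set ν : Measure E := volume.withDensity fun y => ρf (x - y) with hν
    haveI : IsProbabilityMeasure ν :=
      ⟨by rw [hν, withDensity_apply _ MeasurableSet.univ, Measure.restrict_univ, hmassx]⟩
    have hJ := FunctionSpaces.rpow_lintegral_le_lintegral_rpow (ν := ν)
      (hgm.enorm.mono_ac (withDensity_absolutelyContinuous _ _)) hq
    rw [hν, lintegral_withDensity_eq_lintegral_mul₀ hρxm hgm.enorm,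
      lintegral_withDensity_eq_lintegral_mul₀ hρxm (hgm.enorm.pow_const q)] at hJ
    simp only [Pi.mul_apply] at hJ
    calc ‖∫ y, scaledMollifier η δ (x - y) • g y‖ₑ ^ q
        ≤ (∫⁻ y, ρf (x - y) * ‖g y‖ₑ) ^ q := ENNReal.rpow_le_rpow h1 hq0.le
      _ ≤ ∫⁻ y, ρf (x - y) * ‖g y‖ₑ ^ q := hJ
  -- integrate over `B_R`, swap the integrals, use translation invariance
  have hF : AEMeasurable (uncurry fun x y => ρf (x - y) * ‖g y‖ₑ ^ q) (volume.prod volume) :=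
    (hρm.comp measurable_sub).aemeasurable.mul ((hgm.enorm.comp_snd).pow_const q)
  calc ∫⁻ x in ball (0 : E) R, ‖mollifiedDrift η ε w t x‖ₑ ^ q
      ≤ ∫⁻ x in ball (0 : E) R, ∫⁻ y, ρf (x - y) * ‖g y‖ₑ ^ q :=
        setLIntegral_mono' measurableSet_ball hpt
    _ ≤ ∫⁻ x, ∫⁻ y, ρf (x - y) * ‖g y‖ₑ ^ q := lintegral_mono' Measure.restrict_le_self le_rfl
    _ = ∫⁻ y, ∫⁻ x, ρf (x - y) * ‖g y‖ₑ ^ q := lintegral_lintegral_swap hF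
    _ = ∫⁻ y, (∫⁻ x, ρf (x - y)) * ‖g y‖ₑ ^ q := by
        refine lintegral_congr fun y => ?_
        have hm : Measurable fun x => ρf (x - y) := hρm.comp (measurable_sub_const y)
        rw [lintegral_mul_const _ hm]
    _ = ∫⁻ y, ‖g y‖ₑ ^ q := by
        refine lintegral_congr fun y => ?_
        rw [lintegral_sub_right_eq_self ρf y, hmass, one_mul]
    _ = ∫⁻ x in ball (0 : E) R', ‖w t x‖ₑ ^ q := by
        rw [← lintegral_indicator measurableSet_ball]
        refine lintegral_congr fun y => ?_
        rw [hg]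
        by_cases hy : y ∈ ball (0 : E) R'
        · rw [indicator_of_mem hy, indicator_of_mem hy]
        · rw [indicator_of_notMem hy, indicator_of_notMem hy, enorm_zero,
            ENNReal.zero_rpow_of_pos hq0]

/-- **(3.10) along the scaling orbit** (Bradshaw–Tsai 2019, p. 9): if `ερ ≤ λ − 1` then for
`0 < t ≤ 1` the scale `δ = ε√t` satisfies `δρ ≤ λ − 1 ≤ λ^{k+1} − λᵏ` ("`supp η_{ε√s} ⊂ B_{λ−1}`.
Note `λᵏ + (λ−1) ≤ λ^{k+1}` for all `k ≥ 0`"), whence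
`∫_{B_{λᵏ}} |(η_{ε√t} * w(t))|^q ≤ ∫_{B_{λ^{k+1}}} |w(t)|^q` for every `k ∈ ℕ`, `q ≥ 1`
("`‖(η_{ε√s} * v_ε)(s)‖_{L^q(B_λ)} ≤ C(q,η)‖v_ε(s)‖_{L^q(B_{λ²})}` … also valid if `B_λ` is
replaced by `B_{λ²}`"). [cite: BradshawTsai2019, §3 (3.10)] -/
theorem setLIntegral_ball_pow_enorm_mollifiedDrift_rpow_le {c : ℝ} (hc : 1 < c) {η : E → ℝ}
    (hηc : Continuous η) (hη0 : ∀ y, 0 ≤ η y) (hη1 : ∫ y, η y = 1) {ρ : ℝ}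
    (hηρ : ∀ y, ρ ≤ ‖y‖ → η y = 0) {ε : ℝ} (hε : 0 < ε) (hερ : ε * ρ ≤ c - 1)
    {w : ℝ → E → F} {t : ℝ} (ht0 : 0 < t) (ht1 : t ≤ 1)
    (hwt : AEStronglyMeasurable (w t) volume) {q : ℝ} (hq : 1 ≤ q) (k : ℕ) :
    ∫⁻ x in ball (0 : E) (c ^ k), ‖mollifiedDrift η ε w t x‖ₑ ^ q ≤
      ∫⁻ x in ball (0 : E) (c ^ (k + 1)), ‖w t x‖ₑ ^ q := by
  -- `ρ > 0`: otherwise `η` vanishes identically, contradicting `∫η = 1`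
  have hρ : 0 < ρ := by
    by_contra hρ
    have hzero : η = fun _ => 0 := funext fun y => hηρ y ((not_lt.1 hρ).trans (norm_nonneg y))
    rw [hzero, integral_zero] at hη1
    exact zero_ne_one hη1
  have hsqrt1 : Real.sqrt t ≤ 1 := Real.sqrt_le_one.mpr ht1
  have hδ : 0 < ε * Real.sqrt t := mul_pos hε (Real.sqrt_pos.2 ht0)
  refine setLIntegral_ball_enorm_mollifiedDrift_rpow_le hηc hη0 hη1 hηρ hwt hδ ?_ hq
  have h1 : ε * Real.sqrt t * ρ ≤ ε * ρ := by
    rw [mul_right_comm]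
    exact mul_le_of_le_one_right (mul_nonneg hε.le hρ.le) hsqrt1
  have h2 : c - 1 ≤ c ^ (k + 1) - c ^ k := by
    rw [pow_succ]
    have hk : 1 ≤ c ^ k := one_le_pow₀ hc.le
    nlinarith
  linarith

end General

end BradshawTsai2019

end Literature.Analysis.FluidPDE

end
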